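import Mathlib.AlgebraicGeometry.Morphisms.FiniteType
import Mathlib.AlgebraicGeometry.Morphisms.QuasiCompact
import Mathlib.Topology.Algebra.MvPolynomial
import Literature.NumberTheory.Transcendental.Analytification
import Literature.NumberTheory.Transcendental.AnalytificationProofs
import HarnessLib

/-!
# `X(ℂ)` is second countable for `X` of finite type (proof file)

Sibling proof file of `Literature/NumberTheory/Transcendental/Analytification.lean`. That file
vendors as a *named fact* `Literature.ComplexPoints.secondCountableTopology_of_compactSpace X`: for a
scheme `X` locally of finite type over a subfield `k ⊆ ℂ` whose underlying space is quasi-compact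
(`[CompactSpace X.left]`, so `X` is of finite type), the space of complex points `X(ℂ)` with its
strong (analytic) topology `AlgPoints.instTopologicalSpace` is second countable. This file
**discharges that fact** (`Literature.AlgebraicGeometry.Motives.ComplexPoints.secondCountableTopology_of_compactSpace_holds`) from
Mathlib and the accepted `AlgPoints` API alone.

The printed source is Serre, GAGA §2 n°5 (p. 9): the topology of `X^h` is «la moins fine rendant
continues les fonctions régulières sur les sous-ensembles Z-ouverts de `X`» (Remarque; this is
`AlgPoints.instTopologicalSpace`), and «comme `X^h` peut être recouvert par un nombre fini
d'ouverts possédant des cartes, `X^h` est un espace localement compact dénombrable à l'infini»,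
a chart (n°5 Lemme 1) being a Z-locally-closed subset `U ⊆ ℂⁿ` with the topology induced from
`ℂⁿ`; a finite union of subspaces of the second-countable spaces `ℂⁿ` is second countable.

## Proof

Everything except the last step is proved for `L`-points over any field `L ⊇ k`.

* `Literature.AlgebraicGeometry.Motives.AlgPoints.eval_eq_stalkClosedPointTo`: the value `f(P)` is the image of the germ of `f`
  under Mathlib's `Scheme.stalkClosedPointTo P : 𝒪_{X, P.pt} ⟶ L`; hence
  `Literature.AlgebraicGeometry.Motives.AlgPoints.eval_ne_zero_iff_mem_basicOpen` (`f(P) ≠ 0 ↔ P.pt ∈ D(f)`, Mathlib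
  `Scheme.evaluation_ne_zero_iff_mem_basicOpen`) and `Literature.AlgebraicGeometry.Motives.AlgPoints.eval_appLE_top` (evaluation
  is `k`-linear: a scalar `c ∈ k = Γ(Spec k, 𝒪)` pulled back to `Γ(X, U)` takes the value `c`,
  by the `Over` condition `P ≫ (X → Spec k) = Spec (k → L)` and
  `Scheme.germ_stalkClosedPointTo_Spec`).
* `Literature.AlgebraicGeometry.Motives.AlgPoints.exists_eval_eq_mvPolynomial_eval`: on an affine open `U` of `X` locally of finite
  type over `k`, `Γ(X, U)` is a finitely generated `k`-algebra (`Scheme.Hom.finiteType_appLE`,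
  `Algebra.FiniteType.iff_quotient_mvPolynomial''`), so there are coordinates
  `x₁, …, xₙ ∈ Γ(X, U)` such that every `a ∈ Γ(X, U)` is, on `U(L)`, a polynomial over `L` in the
  functions `xⱼ`.
* `Literature.AlgebraicGeometry.Motives.AlgPoints.exists_isOpen_inter_preimage_subset_basicSet` (Serre's Lemme 1 in the form
  needed): with `Φ = (x₁, …, xₙ) : Uₐ(L) → Lⁿ` the coordinate map of an affine open `Uₐ`, every
  sub-basic open set `{Q ∈ U(L) | f(Q) ∈ V}` of the strong topology is, near a point of `Uₐ(L)`,
  of the form `Uₐ(L) ∩ Φ⁻¹(W)` with `W ⊆ Lⁿ` open: shrink to a basic open `D(g) ⊆ U ∩ Uₐ` of `Uₐ`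
  (`IsAffineOpen.exists_basicOpen_le`), write `f|_{D(g)} = a / gᵐ`
  (`IsAffineOpen.isLocalization_basicOpen`) and `a`, `g` as polynomials `pₐ`, `p_g` in the `xⱼ`;
  then `W = {p_g ≠ 0} ∩ (pₐ / p_gᵐ)⁻¹(V)`.
* `Literature.AlgebraicGeometry.Motives.ComplexPoints.secondCountableTopology_of_compactSpace_holds`: `X` has a finite cover by
  affine opens `Uₐ` (`isCompact_and_isOpen_iff_finite_and_eq_biUnion_affineOpens`); the sets
  `Uₐ(ℂ) ∩ Φₐ⁻¹(O)`, `O` in a countable basis of `ℂⁿ`, are strong-open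
  (`AlgPoints.continuousOn_evalOrZero`) and, by the previous step, generate the strong topology;
  they form a countable subbasis.

## References

* J.-P. Serre, *Géométrie algébrique et géométrie analytique*, Ann. Inst. Fourier **6** (1956),
  1–42, §2 n°5 (Lemme 1; p. 9, the paragraph following Prop. 2 and the Remarque).
* D. Mumford, *The Red Book of Varieties and Schemes*, I §10.
* R. Hartshorne, *Algebraic Geometry*, II §2, Ex. 2.7.
-/

noncomputable section

universe u

open CategoryTheory AlgebraicGeometry Topology TopologicalSpace

namespace Literature.NumberTheory.Transcendental

/-! ### Values of regular functions at `L`-points -/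

section AlgPoints
open Literature.AlgebraicGeometry.Motives (AlgPoints)
open Literature.AlgebraicGeometry.Motives.AlgPoints

variable {k : Type u} [Field k] {X : Literature.AlgebraicGeometry.Motives.SchemeOver k} {L : Type u} [Field L] [Algebra k L]

/-- The value `f(P)` is the image of the germ of `f` under Mathlib's
`Scheme.stalkClosedPointTo P : 𝒪_{X, P.pt} ⟶ L` (both are `Spec L → Spec κ(P.pt) → X` unravelled:
`Scheme.residue_descResidueField`). [Hartshorne II Ex. 2.7] [folklore] -/
theorem _root_.Literature.AlgebraicGeometry.Motives.AlgPoints.eval_eq_stalkClosedPointTo (P : AlgPoints X L) (U : X.left.Opens) (h : P.pt ∈ U)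
    (f : Γ(X.left, U)) :
    P.eval U h f = Scheme.stalkClosedPointTo P.toSpecHom (X.left.presheaf.germ U P.pt h f) :=
  (congrArg (fun φ ↦ (X.left.presheaf.germ U P.pt h ≫ φ) f)
    (Scheme.residue_descResidueField (Scheme.stalkClosedPointTo P.toSpecHom)) : _)

/-- `f(P) ≠ 0` iff the underlying point of `P` lies in the basic open `D(f)` (Mathlib
`Scheme.evaluation_ne_zero_iff_mem_basicOpen`, and `κ(P.pt) → L` is injective).
[Hartshorne II §2] [folklore] -/
theorem _root_.Literature.AlgebraicGeometry.Motives.AlgPoints.eval_ne_zero_iff_mem_basicOpen (P : AlgPoints X L) (U : X.left.Opens) (h : P.pt ∈ U)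
    (f : Γ(X.left, U)) :
    P.eval U h f ≠ 0 ↔ P.pt ∈ X.left.basicOpen f := by
  rw [← Scheme.evaluation_ne_zero_iff_mem_basicOpen]
  exact map_ne_zero_iff P.resHom.hom P.resHom.hom.injective

/-- For `a ∈ Γ(X, U)` and `P ∈ D(g)(L)`, the value at `P` of the image of `a` in
`Γ(X, D(g)) = Γ(X, U)[1/g]` (Mathlib's `algebraMap`, i.e. restriction) is `a(P)`.
[Hartshorne II §2] [folklore] -/
theorem _root_.Literature.AlgebraicGeometry.Motives.AlgPoints.eval_algebraMap_basicOpen (P : AlgPoints X L) {U : X.left.Opens} (g a : Γ(X.left, U))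
    (h : P.pt ∈ X.left.basicOpen g) :
    P.eval (X.left.basicOpen g) h (algebraMap Γ(X.left, U) Γ(X.left, X.left.basicOpen g) a) =
      P.eval U (X.left.basicOpen_le g h) a :=
  eval_map_homOfLE (X.left.basicOpen_le g) a h

/-- Evaluation at an `L`-point is `k`-linear: a scalar `c ∈ Γ(Spec k, 𝒪) = k`, pulled back to
`Γ(X, U)` along the structure morphism, takes the value `c` at every `L`-point (this is the
`Over` condition `P ≫ (X → Spec k) = Spec (k → L)`). [Hartshorne II Ex. 2.7] [folklore] -/
theorem _root_.Literature.AlgebraicGeometry.Motives.AlgPoints.eval_appLE_top (P : AlgPoints X L) {U : X.left.Opens} (h : P.pt ∈ U)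
    (e : U ≤ X.hom ⁻¹ᵁ ⊤) (c : Γ(Spec (.of k), ⊤)) :
    P.eval U h (X.hom.appLE ⊤ U e c) = algebraMap k L ((Scheme.ΓSpecIso (.of k)).hom c) := by
  rw [eval_eq_stalkClosedPointTo, Scheme.Hom.appLE, CategoryTheory.comp_apply,
    TopCat.Presheaf.germ_res_apply, ← Scheme.Hom.germ_stalkMap_apply]
  have H : ∀ y, Scheme.stalkClosedPointTo P.toSpecHom (X.hom.stalkMap P.pt y) =
      Scheme.stalkClosedPointTo (P.toSpecHom ≫ X.hom) y := fun y ↦ by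
    rw [Scheme.stalkClosedPointTo_comp]; rfl
  have key : ∀ g : Spec (.of L) ⟶ Spec (.of k),
      g = Spec.map (CommRingCat.ofHom (algebraMap k L)) →
      ∀ hm, Scheme.stalkClosedPointTo g
        ((Spec (.of k)).presheaf.germ ⊤ (g.base (IsLocalRing.closedPoint L)) hm c) =
        algebraMap k L ((Scheme.ΓSpecIso (.of k)).hom c) := by
    rintro _ rfl hm
    exact (ConcreteCategory.congr_hom (Scheme.germ_stalkClosedPointTo_Spec (R := .of k)
      (CommRingCat.ofHom (algebraMap k L))) c : _)
  rw [H]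
  exact key _ (Over.w P) _

/-! ### Regular functions are polynomials in finitely many coordinates -/

/-- **Regular functions are polynomials in coordinates on `L`-points.** If `X` is locally of
finite type over `k` and `U ⊆ X` is an affine open, there are finitely many sections
`x₁, …, xₙ ∈ Γ(X, U)` (generators of the `k`-algebra `Γ(X, U)`) such that every `a ∈ Γ(X, U)`
is, as a function on `U(L)`, a polynomial with coefficients in `L` in the coordinate functions
`xⱼ`. [Serre, GAGA §2 n°5; Mumford, *Red Book* I §10] [folklore] -/
theorem _root_.Literature.AlgebraicGeometry.Motives.AlgPoints.exists_eval_eq_mvPolynomial_eval [LocallyOfFiniteType X.hom] {U : X.left.Opens}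
    (hU : IsAffineOpen U) :
    ∃ (n : ℕ) (x : Fin n → Γ(X.left, U)), ∀ a : Γ(X.left, U), ∃ p : MvPolynomial (Fin n) L,
      ∀ (Q : AlgPoints X L) (h : Q.pt ∈ U),
        Q.eval U h a = MvPolynomial.eval (fun j ↦ Q.eval U h (x j)) p := by
  have e : U ≤ X.hom ⁻¹ᵁ ⊤ := le_top
  have hft := X.hom.finiteType_appLE (isAffineOpen_top _) hU e
  letI := (X.hom.appLE ⊤ U e).hom.toAlgebra
  obtain ⟨n, F, hF⟩ := Algebra.FiniteType.iff_quotient_mvPolynomial''.mp hft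
  refine ⟨n, fun j ↦ F (MvPolynomial.X j), fun a ↦ ?_⟩
  obtain ⟨p, rfl⟩ := hF a
  let τ : Γ(Spec (.of k), ⊤) →+* L := (algebraMap k L).comp (Scheme.ΓSpecIso (.of k)).hom.hom
  refine ⟨MvPolynomial.map τ p, fun Q h ↦ ?_⟩
  -- evaluation at `Q` as a ring homomorphism `Γ(X, U) →+* L`
  let ε : Γ(X.left, U) →+* L := (X.left.evaluation U Q.pt h ≫ Q.resHom).hom
  have hε : ∀ f, Q.eval U h f = ε f := fun _ ↦ rfl
  rw [MvPolynomial.eval_map]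
  simp only [hε]
  change (ε.comp F.toRingHom) p = MvPolynomial.eval₂Hom τ (fun j ↦ ε (F (MvPolynomial.X j))) p
  congr 1
  refine MvPolynomial.ringHom_ext (fun r ↦ ?_) (fun j ↦ ?_)
  · rw [MvPolynomial.eval₂Hom_C, RingHom.comp_apply, AlgHom.toRingHom_eq_coe,
      AlgHom.coe_toRingHom, ← MvPolynomial.algebraMap_eq, AlgHom.commutes,
      RingHom.algebraMap_toAlgebra, ← hε]
    exact Q.eval_appLE_top h e r
  · simp

/-- **Local structure of the strong topology.** Let `Uₐ ⊆ X` be an affine open with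
coordinates `x₁, …, xₙ` as in `exists_eval_eq_mvPolynomial_eval`, and `Φ : X(L) → Lⁿ` the
coordinate map (extended by `0` off `Uₐ(L)`). Then every sub-basic open set `{Q ∈ U(L) | f(Q) ∈ V}`
of the strong topology is, near a point `P` with `P.pt ∈ Uₐ`, a neighbourhood of the form
`Uₐ(L) ∩ Φ⁻¹(W)` with `W ⊆ Lⁿ` open: shrink to a basic open `D(g) ⊆ U ∩ Uₐ`, write
`f|D(g) = a/gᵐ` and `a`, `g` as polynomials in the `xⱼ`. This is the content of Serre's Lemme 1
(a chart is a Z-locally-closed subset of `ℂⁿ` with the induced topology).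
[cite: SerreGAGA1956, §2 n°5 Lemme 1] -/
theorem _root_.Literature.AlgebraicGeometry.Motives.AlgPoints.exists_isOpen_inter_preimage_subset_basicSet [TopologicalSpace L]
    [IsTopologicalDivisionRing L] [T1Space L] {Ua : X.left.Opens} (hUa : IsAffineOpen Ua)
    {n : ℕ} (x : Fin n → Γ(X.left, Ua))
    (hx : ∀ a : Γ(X.left, Ua), ∃ p : MvPolynomial (Fin n) L, ∀ (Q : AlgPoints X L)
      (h : Q.pt ∈ Ua), Q.eval Ua h a = MvPolynomial.eval (fun j ↦ Q.eval Ua h (x j)) p)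
    (U : X.left.Opens) (f : Γ(X.left, U)) {V : Set L} (hV : IsOpen V)
    {P : AlgPoints X L} (hP : P ∈ basicSet U f V) (hPa : P.pt ∈ Ua) :
    ∃ W : Set (Fin n → L), IsOpen W ∧ (fun j ↦ evalOrZero Ua (x j) P) ∈ W ∧
      {Q | Q.pt ∈ Ua} ∩ (fun Q j ↦ evalOrZero Ua (x j) Q) ⁻¹' W ⊆ basicSet U f V := by
  obtain ⟨hPU, hfP⟩ := hP
  -- a basic open `D(g) ⊆ U ∩ Uₐ` of `Uₐ` around `P.pt`
  obtain ⟨g, hgle, hPg⟩ :=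
    hUa.exists_basicOpen_le (V := U ⊓ Ua) ⟨P.pt, Opens.mem_inf.mpr ⟨hPU, hPa⟩⟩ hPa
  -- `f|D(g) = a / g ^ m`
  have := hUa.isLocalization_basicOpen g
  obtain ⟨⟨a, ⟨_, m, rfl⟩⟩, hfa⟩ := IsLocalization.surj (Submonoid.powers g)
    (X.left.presheaf.map (homOfLE (hgle.trans inf_le_left)).op f)
  obtain ⟨pa, hpa⟩ := hx a
  obtain ⟨pg, hpg⟩ := hx g
  -- the coordinate map on `Uₐ(L)`
  have hΦ : ∀ (Q : AlgPoints X L) (hQ : Q.pt ∈ Ua),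
      (fun j ↦ evalOrZero Ua (x j) Q) = fun j ↦ Q.eval Ua hQ (x j) :=
    fun Q hQ ↦ funext fun j ↦ evalOrZero_of_mem _ hQ
  -- `Q.pt ∈ D(g)` iff `pg (Φ Q) ≠ 0`
  have hmem : ∀ (Q : AlgPoints X L) (hQ : Q.pt ∈ Ua),
      Q.pt ∈ X.left.basicOpen g ↔ MvPolynomial.eval (fun j ↦ evalOrZero Ua (x j) Q) pg ≠ 0 := by
    intro Q hQ
    rw [hΦ Q hQ, ← hpg Q hQ, eval_ne_zero_iff_mem_basicOpen]
  -- on `D(g)(L)`, `f = pa (Φ) / pg (Φ) ^ m`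
  have hval : ∀ (Q : AlgPoints X L) (hQ : Q.pt ∈ X.left.basicOpen g),
      Q.eval U (Opens.mem_inf.mp (hgle hQ)).1 f =
        MvPolynomial.eval (fun j ↦ evalOrZero Ua (x j) Q) pa /
          MvPolynomial.eval (fun j ↦ evalOrZero Ua (x j) Q) pg ^ m := by
    intro Q hQ
    have hQa : Q.pt ∈ Ua := X.left.basicOpen_le g hQ
    have hg0 : Q.eval Ua hQa g ≠ 0 := (Q.eval_ne_zero_iff_mem_basicOpen Ua hQa g).mpr hQ
    -- evaluation at `Q` as a ring homomorphism `Γ(X, D(g)) →+* L`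
    let ε : Γ(X.left, X.left.basicOpen g) →+* L :=
      (X.left.evaluation (X.left.basicOpen g) Q.pt hQ ≫ Q.resHom).hom
    have hε : ∀ f', ε f' = Q.eval (X.left.basicOpen g) hQ f' := fun _ ↦ rfl
    have key := congrArg ε hfa
    simp only [map_mul, map_pow] at key
    simp only [hε, eval_algebraMap_basicOpen] at key
    rw [eval_map_homOfLE] at key
    rw [hΦ Q hQa, ← hpa Q hQa, ← hpg Q hQa, eq_div_iff (pow_ne_zero m hg0)]
    exact key
  refine ⟨{z | MvPolynomial.eval z pg ≠ 0} ∩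
      (fun z ↦ MvPolynomial.eval z pa / MvPolynomial.eval z pg ^ m) ⁻¹' V, ?_, ?_, ?_⟩
  · refine ContinuousOn.isOpen_inter_preimage ?_
      (isOpen_compl_singleton.preimage (MvPolynomial.continuous_eval pg)) hV
    exact (MvPolynomial.continuous_eval pa).continuousOn.div
      ((MvPolynomial.continuous_eval pg).continuousOn.pow m) fun z hz ↦ pow_ne_zero m hz
  · refine ⟨(hmem P hPa).mp hPg, ?_⟩
    simp only [Set.mem_preimage]
    rw [← hval P hPg]
    exact hfP
  · rintro Q ⟨hQa : Q.pt ∈ Ua, hQg, hQV : _ ∈ V⟩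
    have hQ : Q.pt ∈ X.left.basicOpen g := (hmem Q hQa).mpr hQg
    exact ⟨(Opens.mem_inf.mp (hgle hQ)).1, by rwa [hval Q hQ]⟩

end AlgPoints

/-! ### The named fact -/

section ComplexPoints
open Literature.AlgebraicGeometry.Motives (ComplexPoints)
open Literature.AlgebraicGeometry.Motives.ComplexPoints

variable {k : Type} [Field k] [Algebra k ℂ] (X : Literature.AlgebraicGeometry.Motives.SchemeOver k)

/-- **`X(ℂ)` is second countable for `X` of finite type over `k ⊆ ℂ`**: the named fact
`Literature.AlgebraicGeometry.Motives.ComplexPoints.secondCountableTopology_of_compactSpace` of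
`Literature/NumberTheory/Transcendental/Analytification.lean` holds. Proof: `X` is a finite union
of affine opens `Uₐ` (quasi-compactness); on each, finitely many coordinates `x₁, …, xₙ` (finite
type) give a map `Φₐ : Uₐ(ℂ) → ℂⁿ`, continuous for the strong topology, and every strong-open set
is locally of the form `Uₐ(ℂ) ∩ Φₐ⁻¹(W)` (`AlgPoints.exists_isOpen_inter_preimage_subset_basicSet`);
hence the sets `Uₐ(ℂ) ∩ Φₐ⁻¹(O)`, `O` in a countable basis of `ℂⁿ`, form a countable subbasis.
This is Serre's argument «comme `X^h` peut être recouvert par un nombre fini d'ouverts possédant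
des cartes, `X^h` est un espace localement compact dénombrable à l'infini».
[cite: SerreGAGA1956, §2 n°5, p. 9 (paragraph after Prop. 2) and Lemme 1] -/
theorem _root_.Literature.AlgebraicGeometry.Motives.ComplexPoints.secondCountableTopology_of_compactSpace_holds :
    secondCountableTopology_of_compactSpace X := by
  intro _ _
  -- a finite affine open cover of the scheme `X`
  obtain ⟨s, hs, hcov⟩ := (isCompact_and_isOpen_iff_finite_and_eq_biUnion_affineOpens
    (X := X.left) (U := Set.univ)).mp ⟨isCompact_univ, isOpen_univ⟩
  -- coordinates on each affine open
  choose n x hx using fun U : X.left.affineOpens ↦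
    Literature.AlgebraicGeometry.Motives.AlgPoints.exists_eval_eq_mvPolynomial_eval (X := X) (L := ℂ) U.2
  -- the coordinate maps and the countable subbasis
  let Φ : ∀ U : X.left.affineOpens, ComplexPoints X → (Fin (n U) → ℂ) :=
    fun U P j ↦ Literature.AlgebraicGeometry.Motives.AlgPoints.evalOrZero U.1 (x U j) P
  let 𝒮 : Set (Set (ComplexPoints X)) := ⋃ U ∈ s,
    (fun O ↦ {P | P.pt ∈ (U : X.left.Opens)} ∩ Φ U ⁻¹' O) '' countableBasis (Fin (n U) → ℂ)
  have hΦ : ∀ U : X.left.affineOpens, ContinuousOn (Φ U) {P | P.pt ∈ (U : X.left.Opens)} :=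
    fun U ↦ continuousOn_pi.mpr fun j ↦ Literature.AlgebraicGeometry.Motives.AlgPoints.continuousOn_evalOrZero _ _
  have h𝒮 : ∀ S ∈ 𝒮, IsOpen S := by
    intro S hS
    simp only [𝒮, Set.mem_iUnion, Set.mem_image] at hS
    obtain ⟨U, -, O, hO, rfl⟩ := hS
    exact (hΦ U).isOpen_inter_preimage (Literature.AlgebraicGeometry.Motives.AlgPoints.isOpen_setOf_pt_mem _)
      (isOpen_of_mem_countableBasis hO)
  refine ⟨⟨𝒮, hs.countable.biUnion fun U _ ↦ (countable_countableBasis _).image _,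
    le_antisymm (le_generateFrom_iff_subset_isOpen.mpr h𝒮) ?_⟩⟩
  refine le_generateFrom_iff_subset_isOpen.mpr ?_
  rintro _ ⟨U, f, V, hV, rfl⟩
  change IsOpen[generateFrom 𝒮] (Literature.AlgebraicGeometry.Motives.AlgPoints.basicSet U f V)
  rw [@isOpen_iff_forall_mem_open]
  intro P hP
  -- `P.pt` lies in some affine open `Uₐ ∈ s`
  have hPs : P.pt ∈ ⋃ i ∈ s, ((i : X.left.Opens) : Set X.left) := hcov ▸ Set.mem_univ _
  simp only [Set.mem_iUnion] at hPs
  obtain ⟨Ua, hUas, hPa⟩ := hPs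
  obtain ⟨W, hW, hPW, hWsub⟩ := Literature.AlgebraicGeometry.Motives.AlgPoints.exists_isOpen_inter_preimage_subset_basicSet
    Ua.2 (x Ua) (hx Ua) U f hV hP hPa
  -- shrink `W` to a member of the countable basis
  obtain ⟨O, hO, hPO, hOW⟩ := (isBasis_countableBasis _).exists_subset_of_mem_open hPW hW
  refine ⟨{Q | Q.pt ∈ (Ua : X.left.Opens)} ∩ Φ Ua ⁻¹' O, ?_, ?_, ⟨hPa, hPO⟩⟩
  · exact (Set.inter_subset_inter_right _ (Set.preimage_mono hOW)).trans hWsub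
  · exact isOpen_generateFrom_of_mem (Set.mem_biUnion hUas ⟨O, hO, rfl⟩)

end ComplexPoints

end Literature.NumberTheory.Transcendental
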